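import Summits.AtomisticToContinuum.FouriersLaw.Theses.CageBudgetFekete
import Summits.AtomisticToContinuum.FouriersLaw.Theses.HoelderEscapeProfile
import Summits.AtomisticToContinuum.FouriersLaw.Theorems.HoelderEscapeProfileFibreCalculus
import Summits.AtomisticToContinuum.FouriersLaw.Theorems.HoelderEscapeProfileFibreCalculusStubBochnerPositivity
import Summits.AtomisticToContinuum.FouriersLaw.Theorems.CageBudgetFeketeHeatVarianceCalculus
import Literature.MathematicalPhysics.KineticTheory.ZeroWavenumberDataOfClustering
import Literature.MathematicalPhysics.KineticTheory.InfiniteChainGoodSetSymmetries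
import HarnessLib

/-!
# `CageBudgetFekete.UnboundedHeatVariance`, line Sketch — Abel profile domination (edge D)

Support file (`--supports stmt-AtomisticToContinuum-15771`) for the stub `stub_abelProfileDomination`
of line `Sketch`.

In the arena of the crux let `S(x,t) = Cov(h₀, h_x ∘ φ_t)` be the energy kernel (`h` the split-bond site
energy) and `S̄_ν(x) = Sb ν x = ν ∫₀^∞ e^{-νt} S(x,t) dt` its Abel profile. **Edge D**: the Abel profile is
dominated by its value at the origin, `|S̄_ν(x)| ≤ S̄_ν(0)` for every `ν > 0` and every site `x`.

Proof (canonical reduction, no Fourier inversion):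
* RIGIDITY (`HeatVarianceCalculus.CanonicalRigidity.flow_ae_eq_canonical`): the guarded `D` agrees `μ`-a.e.
  at all times with the canonical Buttà–Marchioro dynamics `D♭` of `OscillatorChain.exists_bmDynamics`
  (carrier `bmGood`, measurable flow, identity off `bmGood`), so `S` is the kernel of `D♭`;
* POSITIVE-DEFINITENESS of `x ↦ S̄_ν(x)` on `ℤ` (`FibreCalculusSketch.bp_sum_sum_laplace_nonneg`, the
  Bochner half of the landed fibre calculus; Laplace integrability of `S(x,·)` is clause (3) of
  `FibreCalculusSketch.fibreCalculus_proof`); on the two-point set `{0, x}` with weights `(1, ±1)` it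
  gives the symmetrised bound `|S̄_ν(x) + S̄_ν(-x)| ≤ 2 S̄_ν(0)`;
* EVENNESS `S(-x,t) = S(x,t)` (`integral_centred_mul_flow_neg_site`): time reversal (`μ` is
  momentum-reversal invariant, `h_x ∘ R = h_x`, `φ_t ∘ R = R ∘ φ_{-t}` everywhere for `D♭`,
  `InfiniteChainDynamics.flow_chainReversal_of_eq_id`) turns `S(x,t)` into `S(x,-t)`; stationarity
  (`φ_t` preserves `μ`, `φ_{-t} ∘ φ_t = id`) into `∫ (h₀∘φ_t - m)(h_x - m)`; the translation `τ_x`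
  (shift invariance of `μ`, `φ_t ∘ τ_x = τ_x ∘ φ_t`) into `S(-x,t)`.

The corollary `totalEscape_of_noFrozenSiteEnergy` combines edge D with "no frozen site energy"
(`S̄_ν(0) → 0` as `ν ↓ 0`) into TOTAL ESCAPE `sup_x |S̄_ν(x)| → 0`.
-/

noncomputable section

namespace Summit.AtomisticToContinuum.FouriersLaw.Theorems.UnboundedHeatVariance.Sketch

open MeasureTheory Set Filter Topology
open Literature.MathematicalPhysics.KineticTheory.HeatConduction

/-- **A real positive-definite even function on `ℤ` is dominated by its value at `0`.** If
`0 ≤ Σ_{a,b∈F} c_a c_b f(b-a)` for all finite `F ⊆ ℤ` and real weights `c`, and `f(-x) = f(x)`, then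
`|f x| ≤ f 0` (two-point sets `{0,x}`, weights `(1, ±1)`). [folklore] -/
theorem abs_le_of_posDef_even (f : ℤ → ℝ)
    (hpd : ∀ (F : Finset ℤ) (c : ℤ → ℝ), 0 ≤ ∑ a ∈ F, ∑ b ∈ F, c a * c b * f (b - a))
    (heven : ∀ x : ℤ, f (-x) = f x) (x : ℤ) : |f x| ≤ f 0 := by
  have h0 : 0 ≤ f 0 := by simpa using hpd {0} (fun _ => 1)
  rcases eq_or_ne x 0 with rfl | hx
  · rw [abs_of_nonneg h0]
  have hx' : (0 : ℤ) ≠ x := hx.symm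
  have hplus := hpd {0, x} (fun _ => 1)
  have hminus := hpd {0, x} (fun z => if z = 0 then 1 else -1)
  simp only [Finset.sum_pair hx', sub_zero, zero_sub, sub_self, heven, one_mul, mul_one,
    if_true, if_neg hx, mul_neg, neg_mul, neg_neg] at hplus hminus
  rw [abs_le]
  constructor <;> linarith

/-- **Evenness in the site of the centred two-point function along a reversible homogeneous flow.**
For a shift-invariant, momentum-reversal-invariant `μ` preserved by a dynamics `D` whose (measurable)
flow commutes everywhere with the translations, is reversed by the momentum reversal
(`φ_t ∘ R = R ∘ φ_{-t}`) and satisfies `φ_{-t} ∘ φ_t = id`: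
`∫ (h₀ - m)((h_{-x} - m) ∘ φ_t) dμ = ∫ (h₀ - m)((h_x - m) ∘ φ_t) dμ` (time reversal, stationarity,
translation by `x`). [folklore] -/
theorem integral_centred_mul_flow_neg_site {P : OscillatorChain} (D : InfiniteChainDynamics P)
    {μ : Measure ChainConfig} (hSI : IsShiftInvariant μ) (hR : MeasurePreserving chainReversal μ μ)
    (hD : D.PreservesMeasure μ) (hmeas : ∀ t : ℝ, Measurable (D.flow t))
    (hcomm : ∀ (t : ℝ) (x : ℤ) (σ : ChainConfig), D.flow t (chainShift x σ) = chainShift x (D.flow t σ))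
    (hrev : ∀ (t : ℝ) (σ : ChainConfig), D.flow t (chainReversal σ) = chainReversal (D.flow (-t) σ))
    (hcancel : ∀ (t : ℝ) (σ : ChainConfig), D.flow (-t) (D.flow t σ) = σ)
    (hUm : Measurable P.U) (hVm : Measurable P.V) (m t : ℝ) (x : ℤ) :
    ∫ σ, (P.energyDensityZ σ 0 - m) * (P.energyDensityZ (D.flow t σ) (-x) - m) ∂μ =
      ∫ σ, (P.energyDensityZ σ 0 - m) * (P.energyDensityZ (D.flow t σ) x - m) ∂μ := by
  have hmeasI : ∀ (s : ℝ) (a b : ℤ),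
      Measurable fun σ : ChainConfig => (P.energyDensityZ σ a - m) * (P.energyDensityZ (D.flow s σ) b - m) :=
    fun s a b => ((P.measurable_energyDensityZ hUm hVm a).sub_const m).mul
      (((P.measurable_energyDensityZ hUm hVm b).comp (hmeas s)).sub_const m)
  -- (i) time reversal: `t ↦ -t`
  have e1 : ∫ σ, (P.energyDensityZ σ 0 - m) * (P.energyDensityZ (D.flow t σ) x - m) ∂μ =
      ∫ σ, (P.energyDensityZ σ 0 - m) * (P.energyDensityZ (D.flow (-t) σ) x - m) ∂μ := by
    refine (integral_comp_eq_of_measurePreserving hR (hmeasI t 0 x)).symm.trans ?_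
    refine integral_congr_ae (Eventually.of_forall fun σ => ?_)
    simp only [hrev, OscillatorChain.energyDensityZ_chainReversal]
  -- (ii) stationarity: move `φ_{-t}` onto the first factor
  have e2 : ∫ σ, (P.energyDensityZ σ 0 - m) * (P.energyDensityZ (D.flow (-t) σ) x - m) ∂μ =
      ∫ σ, (P.energyDensityZ (D.flow t σ) 0 - m) * (P.energyDensityZ σ x - m) ∂μ := by
    refine (integral_comp_eq_of_measurePreserving (hD.2 t) (hmeasI (-t) 0 x)).symm.trans ?_
    refine integral_congr_ae (Eventually.of_forall fun σ => ?_)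
    simp only [hcancel]
  -- (iii) translation by `x`
  have e3 : ∫ σ, (P.energyDensityZ (D.flow t σ) 0 - m) * (P.energyDensityZ σ x - m) ∂μ =
      ∫ σ, (P.energyDensityZ σ 0 - m) * (P.energyDensityZ (D.flow t σ) (-x) - m) ∂μ := by
    refine Eq.trans ?_ (integral_comp_eq_of_measurePreserving (hSI.measurePreserving_chainShift x)
      (hmeasI t 0 (-x)))
    refine integral_congr_ae (Eventually.of_forall fun σ => ?_)
    simp only [hcomm, OscillatorChain.energyDensityZ_chainShift, zero_add, neg_add_cancel]
    ring
  exact (e1.trans (e2.trans e3)).symm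

/-- **Stub `stub_abelProfileDomination`** (edge D of line `Sketch` of `CageBudgetFekete.UnboundedHeatVariance`).
In the arena of the crux, with the energy kernel `S(x,t) = Cov(h₀, h_x ∘ φ_t)` and its Abel profile
`Sb ν x = ν∫₀^∞ e^{-νt} S(x,t) dt`: `|Sb ν x| ≤ Sb ν 0` for every `ν > 0` and every `x : ℤ` — the Abel
profile is positive-definite on `ℤ` (Bochner half of the landed fibre calculus, for the canonical dynamics
that the guarded `D` equals a.e.) and even in `x` (time reversal + stationarity + translation). -/
theorem stub_abelProfileDomination :
    ∀ ω₂ lam β γ : ℝ, 0 < ω₂ → 0 < lam → 0 < β → ∀ T : ℝ, 0 < T → ∀ μ : MeasureTheory.Measure Literature.MathematicalPhysics.KineticTheory.HeatConduction.ChainConfig, (Literature.MathematicalPhysics.KineticTheory.HeatConduction.pinnedChain ω₂ lam β γ).IsChainGibbsMeasure T μ → Literature.MathematicalPhysics.KineticTheory.HeatConduction.IsShiftInvariant μ → μ.map (fun σ : Literature.MathematicalPhysics.KineticTheory.HeatConduction.ChainConfig => fun x : ℤ => ((σ x).1, -(σ x).2)) = μ → ∀ D : Literature.MathematicalPhysics.KineticTheory.HeatConduction.InfiniteChainDynamics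 (Literature.MathematicalPhysics.KineticTheory.HeatConduction.pinnedChain ω₂ lam β γ), D.PreservesMeasure μ → (∀ t : ℝ, ∀ᵐ σ ∂μ, D.flow t (Literature.MathematicalPhysics.KineticTheory.HeatConduction.shift σ) = Literature.MathematicalPhysics.KineticTheory.HeatConduction.shift (D.flow t σ)) → (∀ t : ℝ, D.HasAbsConvergentCorrelation μ t) → Continuous (fun t : ℝ => D.currentCorrelation μ t) → ∀ h : Literature.MathematicalPhysics.KineticTheory.HeatConduction.ChainConfig → ℤ → ℝ, h = (fun (σ : Literature.MathematicalPhysics.KineticTheory.HeatConduction.ChainConfig) (x : ℤ) => (σ x).2 ^ 2 / 2 + (Literature.MathematicalPhysics.KineticTheory.HeatConduction.pinnedChain ω₂ lam β γ).U (σ x).1 + ((Literature.MathematicalPhysics.KineticTheory.HeatConduction.pinnedChain ω₂ lam β γ).V ((σ (x + 1)).1 - (σ x).1) + (Literature.MathematicalPhysics.KineticTheory.HeatConduction.pinnedChain ω₂ lam β γ).V ((σ x).1 - (σ (x - 1)).1)) / 2) → ∀ S : ℤ → ℝ → ℝ, S = (fun (x : ℤ) (t : ℝ) => ∫ σ, (h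 σ 0 - ∫ σ', h σ' 0 ∂μ) * (h (D.flow t σ) x - ∫ σ', h σ' 0 ∂μ) ∂μ) → ∀ Sb : ℝ → ℤ → ℝ, Sb = (fun (ν : ℝ) (x : ℤ) => ν * ∫ t in Set.Ioi (0:ℝ), Real.exp (-(ν * t)) * S x t) → ∀ ν : ℝ, 0 < ν → ∀ x : ℤ, |Sb ν x| ≤ Sb ν 0 := by
  intro ω₂ lam β γ hω hl hβ T hT μ hG hSI hRefl D hP hShift _ _ h hh S hS Sb hSb ν hν x
  -- clause (3) of the landed fibre calculus: Laplace integrability of `S(x,·)`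
  obtain ⟨-, -, h3, -⟩ :=
    Summit.AtomisticToContinuum.FouriersLaw.Theorems.FibreCalculusSketch.fibreCalculus_proof ω₂ lam β γ hω hl hβ T
      hT μ hG hSI hRefl D hP hShift h hh S hS Sb hSb _ rfl _ rfl _ rfl _ rfl
  -- chain data, superstability, the canonical dynamics, rigidity
  have hss : (pinnedChain ω₂ lam β γ).HasSuperstabilityEstimate μ :=
    OscillatorChain.hasSuperstabilityEstimate_of_isShiftInvariant_pinnedChain γ hω hl.le hβ.le hT hG hSI
  haveI : IsProbabilityMeasure μ := hss.1
  have hU0 : ∀ q : ℝ, 0 ≤ (pinnedChain ω₂ lam β γ).U q := OscillatorChain.pinnedChain_U_nonneg β γ hω.le hl.le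
  have hV0 : ∀ r : ℝ, 0 ≤ (pinnedChain ω₂ lam β γ).V r := OscillatorChain.pinnedChain_V_nonneg ω₂ lam γ hβ.le
  have hUm : Measurable (pinnedChain ω₂ lam β γ).U := OscillatorChain.measurable_pinnedChain_U ω₂ lam β γ
  have hVm : Measurable (pinnedChain ω₂ lam β γ).V := OscillatorChain.measurable_pinnedChain_V ω₂ lam β γ
  have hU2 : OscillatorChain.IsEvenPolyOfDegree (pinnedChain ω₂ lam β γ).U 2 :=
    OscillatorChain.pinnedChain_isEvenPolyOfDegree_U β γ hω.le hl
  have hV2 : OscillatorChain.IsEvenPolyOfDegree (pinnedChain ω₂ lam β γ).V 2 :=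
    OscillatorChain.pinnedChain_isEvenPolyOfDegree_V ω₂ lam γ hβ
  obtain ⟨D', hcar, hmeas, hid, -, -, -, hpresAll⟩ :=
    OscillatorChain.exists_bmDynamics (P := pinnedChain ω₂ lam β γ) one_le_two one_le_two hU2 hV2
  have hP' : D'.PreservesMeasure μ := hpresAll T μ hG hss
  have hrig := HeatVarianceCalculus.CanonicalRigidity.flow_ae_eq_canonical γ hω hl hβ hT hG hSI D D' hP hcar
  have hφ : ∀ (t : ℝ) (y : ℤ) (σ : ChainConfig), D'.flow t (chainShift y σ) = chainShift y (D'.flow t σ) :=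
    fun t y σ => D'.flow_chainShift_of_eq_id hcar hid hU0 hV0 t y σ
  have hRφ : ∀ (t : ℝ) (σ : ChainConfig), D'.flow t (chainReversal σ) = chainReversal (D'.flow (-t) σ) :=
    fun t σ => D'.flow_chainReversal_of_eq_id hcar hid t σ
  have hcancel : ∀ (t : ℝ) (σ : ChainConfig), D'.flow (-t) (D'.flow t σ) = σ := fun t σ => by
    rw [← D'.flow_add_of_eq_id hcar hid, neg_add_cancel, D'.flow_zero_of_eq_id hcar hid]
  have hR : MeasurePreserving chainReversal μ μ := ⟨measurable_chainReversal, hRefl⟩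
  -- `S` is the kernel of the canonical dynamics
  have hh' : h = fun (σ : ChainConfig) (y : ℤ) => (pinnedChain ω₂ lam β γ).energyDensityZ σ y := hh
  have hS' : S = fun (y : ℤ) (t : ℝ) => ∫ σ, ((pinnedChain ω₂ lam β γ).energyDensityZ σ 0 -
        ∫ σ', (pinnedChain ω₂ lam β γ).energyDensityZ σ' 0 ∂μ) *
      ((pinnedChain ω₂ lam β γ).energyDensityZ (D'.flow t σ) y -
        ∫ σ', (pinnedChain ω₂ lam β γ).energyDensityZ σ' 0 ∂μ) ∂μ := by
    subst hh' hS
    funext y t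
    refine integral_congr_ae ?_
    filter_upwards [hrig] with σ hσ
    rw [hσ t]
  -- positive-definiteness of `Sb ν` on `ℤ` (Bochner half of the fibre calculus, canonical dynamics)
  have hpd : ∀ (F : Finset ℤ) (c : ℤ → ℝ), 0 ≤ ∑ a ∈ F, ∑ b ∈ F, c a * c b * Sb ν (b - a) := by
    intro F c
    have e := FibreCalculusSketch.bp_sum_sum_laplace_nonneg hω hl hβ hT hG hSI D' hcar hmeas hid hS' hν
      (fun z => h3 z ν hν) F c
    simpa only [hSb] using e
  -- evenness of `Sb ν` in the site
  have heven : ∀ y : ℤ, Sb ν (-y) = Sb ν y := by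
    intro y
    have hSy : ∀ t : ℝ, S (-y) t = S y t := fun t => by
      rw [hS']
      exact integral_centred_mul_flow_neg_site D' hSI hR hP' hmeas hφ hRφ hcancel hUm hVm _ t y
    simp only [hSb, hSy]
  exact abs_le_of_posDef_even (Sb ν) hpd heven x

/-- **Total escape from no frozen site energy** (edge D combined with the on-site Abel return): in the
arena of the crux, if `Sb ν 0 → 0` as `ν ↓ 0` then `sup_x |Sb ν x| → 0`, quantitatively: for every `ε > 0`
there is `ν₀ > 0` with `|Sb ν x| ≤ ε` for all `0 < ν < ν₀` and all sites `x`. [folklore] -/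
theorem totalEscape_of_noFrozenSiteEnergy :
    ∀ ω₂ lam β γ : ℝ, 0 < ω₂ → 0 < lam → 0 < β → ∀ T : ℝ, 0 < T → ∀ μ : MeasureTheory.Measure Literature.MathematicalPhysics.KineticTheory.HeatConduction.ChainConfig, (Literature.MathematicalPhysics.KineticTheory.HeatConduction.pinnedChain ω₂ lam β γ).IsChainGibbsMeasure T μ → Literature.MathematicalPhysics.KineticTheory.HeatConduction.IsShiftInvariant μ → μ.map (fun σ : Literature.MathematicalPhysics.KineticTheory.HeatConduction.ChainConfig => fun x : ℤ => ((σ x).1, -(σ x).2)) = μ → ∀ D : Literature.MathematicalPhysics.KineticTheory.HeatConduction.InfiniteChainDynamics (Literature.MathematicalPhysics.KineticTheory.HeatConduction.pinnedChain ω₂ lam β γ), D.PreservesMeasure μ → (∀ t : ℝ, ∀ᵐ σ ∂μ, D.flow t (Literature.MathematicalPhysics.KineticTheory.HeatConduction.shift σ) = Literature.MathematicalPhysics.KineticTheory.HeatConduction.shift (D.flow t σ)) → (∀ t : ℝ, D.HasAbsConvergentCorrelation μ t) → Continuous (fun t : ℝ => D.currentCorrelation μ t) → ∀ h : Literature.MathematicalPhysics.KineticTheory.HeatConduction.ChainConfig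 → ℤ → ℝ, h = (fun (σ : Literature.MathematicalPhysics.KineticTheory.HeatConduction.ChainConfig) (x : ℤ) => (σ x).2 ^ 2 / 2 + (Literature.MathematicalPhysics.KineticTheory.HeatConduction.pinnedChain ω₂ lam β γ).U (σ x).1 + ((Literature.MathematicalPhysics.KineticTheory.HeatConduction.pinnedChain ω₂ lam β γ).V ((σ (x + 1)).1 - (σ x).1) + (Literature.MathematicalPhysics.KineticTheory.HeatConduction.pinnedChain ω₂ lam β γ).V ((σ x).1 - (σ (x - 1)).1)) / 2) → ∀ S : ℤ → ℝ → ℝ, S = (fun (x : ℤ) (t : ℝ) => ∫ σ, (h σ 0 - ∫ σ', h σ' 0 ∂μ) * (h (D.flow t σ) x - ∫ σ', h σ' 0 ∂μ) ∂μ) → ∀ Sb : ℝ → ℤ → ℝ, Sb = (fun (ν : ℝ) (x : ℤ) => ν * ∫ t in Set.Ioi (0:ℝ), Real.exp (-(ν * t)) * S x t) → Filter.Tendsto (fun ν : ℝ => Sb ν 0) (nhdsWithin (0:ℝ) (Set.Ioi 0)) (nhds 0) → ∀ ε : ℝ, 0 < ε → ∃ ν₀ : ℝ, 0 < ν₀ ∧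 ∀ ν : ℝ, 0 < ν → ν < ν₀ → ∀ x : ℤ, |Sb ν x| ≤ ε := by
  intro ω₂ lam β γ hω hl hβ T hT μ hG hSI hRefl D hP hShift hA hC h hh S hS Sb hSb hΨ ε hε
  have hdom := stub_abelProfileDomination ω₂ lam β γ hω hl hβ T hT μ hG hSI hRefl D hP hShift hA hC h hh S hS
    Sb hSb
  have hev : ∀ᶠ ν in 𝓝[>] (0:ℝ), Sb ν 0 < ε := hΨ.eventually (gt_mem_nhds hε)
  obtain ⟨ν₀, hν₀, hsub⟩ := (mem_nhdsGT_iff_exists_Ioo_subset).1 hev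
  refine ⟨ν₀, hν₀, fun ν hν hνν₀ x => ?_⟩
  have hlt : Sb ν 0 < ε := hsub ⟨hν, hνν₀⟩
  exact (hdom ν hν x).trans hlt.le

end Summit.AtomisticToContinuum.FouriersLaw.Theorems.UnboundedHeatVariance.Sketch

end
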